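/-
Copyright: the b2b-balaban T⁴-continuum CRUX team, row NE7b OWNER lineage `t4-ne7b-p1` (gen 145). Project licence.
-/
import Summits.QuantumFields.BalabanUV.T4Continuum.Spine.NE7b.SupHessWDerivFDeriv
import Summits.QuantumFields.BalabanUV.T4Continuum.Spine.NE7b.SupKernelSchurQuadrilinear
import Summits.QuantumFields.BalabanUV.T4Continuum.Spine.NE7b.SupInterpolatedFourthKernelEntry
import Summits.QuantumFields.BalabanUV.T4Continuum.Spine.NE7b.SupWeightedFourthOrderLettersThree
import Summits.QuantumFields.BalabanUV.T4Continuum.Spine.NE7b.SupWeightedFourthOrderLettersFour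

/-!
# THE WEIGHTED FOURTH-ORDER OPERATOR LETTER ((534)″; SCOPING-d17 (R-c) at order 4, the operator slot of the class format (535)).  (534)
# bounded `‖Q(ψ)‖` (the Fréchet derivative of the next potential's third-derivative form, (533)) by Schur's test (530) from the entry majorant
# `M` of (526) and the PLAIN slot letters of (531) — which carried the support letters `n, n′` (the located NO, (648)).  THIS FILE redoes it in
# the weighted class: entries bounded by the interpolated majorant `M₄′` (655), slot sums bounded by the WEIGHTED slot letters (664)∕(665)
# (`|Q_{xyzt}| ≤ M₄′ ≤ M₄′·Πϑ` since `ϑ ≥ 1`), whence `‖Q(ψ)‖ ≤ √(B_z·B_t)` with `B_z, B_t` the bounds of (664)∕(665) — no support letter, no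
# finite-range hypothesis (row NE7b, node U5c; (530), (533), (655), (664), (665) BY NAME; [folklore]).  With (662)–(665) (letters), (655)
# (entry) and (533) (derivative) this is the order-4 block of the WEIGHTED class format, cf. (535).

Cell `pub-balaban`, sub-cell `t4`, spine estimate NE7b (`T4WeightBudget.RelWeightBound`; the cell's OWN estimate — NOT PRINTED in
[Bałaban 1983–89], NOT PROVED).  Crux-route work under `Spine/NE7b/` by the row OWNER (`t4-ne7b-p1` gen 145, file (671)) under FREEZE
(0)'s crux-prover clause; NOTHING of Bałaban's is named as a Lean object, valued or asserted; no `T4Continuum/Support` leaf typed; no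
`def`, no notation (`Q(ψ)` and the bounds WRITTEN OUT); zero `sorry`.  Imports (BY NAME): (533) `…SupHessWDerivFDeriv`, (530)
`…SupKernelSchurQuadrilinear`, (655), (664), (665); (458) `posSemidef_AAT` through them.

WHAT IS PROVED ([folklore]): **`weighted_fourth_order_operator_letter`**; toy.

HONEST (what this is NOT).  The operator slot only; the continuity slot is (646)∕(647)-type and unchanged; rates (R-d) later; scalar skeleton
((A3), NC-NE7b-α UNRULED); nothing of Bałaban's asserted.  BY-NAME EFFECT ON THE WALL: NONE.  NE7b NOT PRINTED ∕ NOT PROVED; spine PROVED 0∕9;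
rung (B)+1 — the programme's measures remain FINITE-torus statements; NOT the mass gap, NOT Clay.  HONEST DEPENDENCY: continuum YM on T⁴ ⇐
BetaPertH ∧ nine spine estimates (0∕9 proved); BetaPertH ⇐ (D1) ∧ (D4) ∧ CAP+tail; G-an2-4 gates asym, D1 and NE2∕3∕4.
-/

set_option autoImplicit false
set_option maxSynthPendingDepth 3

noncomputable section

namespace Summit.QuantumFields.BalabanUV.T4Continuum.NE7b.SupWeightedFourthOrderOperatorLetter

open MeasureTheory ProbabilityTheory Finset Real Matrix
open scoped BigOperators Matrix
open SupWhitenedMomentLetters (posSemidef_AAT)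
open SupHessWDerivFDeriv (third_form_clm_fderiv_entry)
open SupKernelSchurQuadrilinear (opNorm_le_of_slot_letters_four)
open SupInterpolatedFourthKernelEntry (interpolated_fourth_kernel_entry)
open SupWeightedFourthOrderLettersThree (output_k4ϑ_z)
open SupWeightedFourthOrderLettersFour (output_k4ϑ_t)

variable {ι κ : Type} [Fintype ι] [DecidableEq ι] [Fintype κ] [DecidableEq κ]

variable {U : EuclideanSpace ℝ ι → ℝ} {U' : EuclideanSpace ℝ ι → EuclideanSpace ℝ ι →L[ℝ] ℝ}
  {U'' : EuclideanSpace ℝ ι → EuclideanSpace ℝ ι →L[ℝ] EuclideanSpace ℝ ι →L[ℝ] ℝ}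
  {U₃ : EuclideanSpace ℝ ι → EuclideanSpace ℝ ι →L[ℝ] EuclideanSpace ℝ ι →L[ℝ] EuclideanSpace ℝ ι →L[ℝ] ℝ}
  {U₄ : EuclideanSpace ℝ ι → EuclideanSpace ℝ ι →L[ℝ] EuclideanSpace ℝ ι →L[ℝ] EuclideanSpace ℝ ι →L[ℝ] EuclideanSpace ℝ ι →L[ℝ] ℝ}
  {Hk : ι → ι → ℝ} {K3 : ι → ι → ι → ℝ} {K4 : ι → ι → ι → ι → ℝ} {A : Matrix ι κ ℝ} {D : κ → κ → ℝ}
  {γop κ₀ κ₁ κ₂ κ₃ κ₄ a τ δ θp lam lamA αr αc hr γ dθ dθ' αθ βθ : ℝ} {θ : κ → κ → ℝ} {σ : ι → κ → ℝ} {ρ r : ι → ι → ℝ}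
  {ϑ ϑ₂ : ι → ι → ℝ} {αθc αg1m αg2m αg1c αk4m1 αk4m2 αk4m3 αk4c hrϑ hcϑ G Θ6 S4 k4ϑ2 k4ϑ3 : ℝ}

set_option maxHeartbeats 1600000 in
/-- **THE WEIGHTED FOURTH-ORDER OPERATOR LETTER** ((534)″): the Fréchet derivative `Q(ψ)` of the next potential's third-derivative form
((533)) has operator norm at most `√(B_z·B_t)`, the geometric mean of the two weighted slot letters (664)∕(665) of `M₄′` — Schur's test (530)
on the entries ((533) + (655)), the plain slot sums being at most the weighted ones (`Πϑ ≥ 1`). [folklore] -/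
theorem weighted_fourth_order_operator_letter [Nonempty κ] (hΓop : (γop • (1 : Matrix ι ι ℝ) - A * Aᵀ).PosSemidef) (Y : Finset ι) (hUd : ∀ φ :
        EuclideanSpace ℝ ι, HasFDerivAt U (U' φ) φ) (hU'd : ∀ φ : EuclideanSpace ℝ ι, HasFDerivAt U' (U'' φ) φ) (hU''d : ∀ φ : EuclideanSpace ℝ ι,
        HasFDerivAt U'' (U₃ φ) φ) (hU₃d : ∀ φ : EuclideanSpace ℝ ι, HasFDerivAt U₃ (U₄ φ) φ) (hU₄c : Continuous U₄) (hκ₀ : 0 ≤ κ₀) (hκ₁ : 0 ≤ κ₁)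
        (ha : 0 ≤ a) (hτ : 0 < τ) (hδ : 0 < δ) (hθ0 : 0 < θp) (hθ1 : θp < 1) (hκθ : (2 * κ₀ * (1 + τ) + 4 * δ) * γop ≤ θp) (hκθw : 2 * κ₀ * (1 + τ)
        * γop + 4 * δ ≤ θp) (hstab : ∀ φ : EuclideanSpace ℝ ι, -(κ₀ * ∑ x ∈ Y, φ x ^ 2) ≤ U φ) (hU'b : ∀ φ : EuclideanSpace ℝ ι, ‖U' φ‖ ≤ κ₁ * (a +
        ∑ x ∈ Y, φ x ^ 2)) (hU''b : ∀ φ : EuclideanSpace ℝ ι, ‖U'' φ‖ ≤ κ₂) (hU₃b : ∀ φ : EuclideanSpace ℝ ι, ‖U₃ φ‖ ≤ κ₃) (hU₄b : ∀ φ :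
        EuclideanSpace ℝ ι, ‖U₄ φ‖ ≤ κ₄) (hlam : 0 ≤ lam) (hUsec : ∀ s : ℝ, 0 ≤ s → s ≤ 1 → ∀ a b : EuclideanSpace ℝ ι, U ((1 - s) • a + s • b) -
        lam / 2 * (s * (1 - s)) * ∑ i, (a i - b i) ^ 2 ≤ (1 - s) * U a + s * U b) (hρg : lam * γop < 1) (hHk : ∀ (φ : EuclideanSpace ℝ ι) (x z :
        ι), |U'' φ (EuclideanSpace.single z (1 : ℝ)) (EuclideanSpace.single x (1 : ℝ))| ≤ Hk x z) (hHk0 : ∀ v u, 0 ≤ Hk v u) (hK3 : ∀ (φ :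
        EuclideanSpace ℝ ι) (u x y : ι), |U₃ φ (EuclideanSpace.single u (1 : ℝ)) (EuclideanSpace.single x (1 : ℝ)) (EuclideanSpace.single y (1 :
        ℝ))| ≤ K3 x y u) (hK30 : ∀ x y u, 0 ≤ K3 x y u) (hK4 : ∀ (φ : EuclideanSpace ℝ ι) (u x y z : ι), |U₄ φ (EuclideanSpace.single u (1 : ℝ))
        (EuclideanSpace.single x (1 : ℝ)) (EuclideanSpace.single y (1 : ℝ)) (EuclideanSpace.single z (1 : ℝ))| ≤ K4 x y z u) (hhr : ∀ v, ∑ u, Hk v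
        u ≤ hr) (ψ : EuclideanSpace ℝ ι) (hαr : ∀ u, ∑ w, |A u w| ≤ αr) (hαc : ∀ w, ∑ u, |A u w| ≤ αc) (hlamA : ∀ x : κ, ∑ u, ∑ v, |A u x| * |A v
        x| * Hk v u ≤ lamA) (hlamA1 : lamA < 1) (hγ : αc * hr * αr / (1 - lamA) ≤ γ) (hγ1 : γ < 1) (hD : ∀ x y, 0 ≤ D x y) (hDC : ∀ x y, (if x = y
        then (1 : ℝ) else 0) + ∑ z, D x z * ((if y = z then 0 else ∑ u, ∑ v, |A u y| * |A v z| * Hk v u) / (1 - lamA)) ≤ D x y) (hθnn : ∀ z w, 0 ≤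
        θ z w) (hDθr : ∀ z, ∑ w, D z w * θ z w ≤ dθ) (hdθ : 0 ≤ dθ) (hDθc : ∀ w, ∑ z, D z w * θ z w ≤ dθ') (hdθ' : 0 ≤ dθ') (hσ0 : ∀ x w, 0 ≤ σ x
        w) (hσθ : ∀ x z w, σ x w ≤ σ x z * θ z w) (hρ1 : ∀ x y, 1 ≤ ρ x y) (hρsymm : ∀ x y, ρ x y = ρ y x) (hρmul : ∀ x y z, ρ x z ≤ ρ x y * ρ y z)
        (hρσ : ∀ x y w, ρ x y ^ 8 ≤ σ x w * σ y w) (hr1 : ∀ x y, 1 ≤ r x y) (hrσ : ∀ x y w, r x y ^ 24 ≤ σ x w * σ y w) (haσ : ∀ v : ι, ∑ w, (∑ u,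
        |A u w| * Hk v u) * σ v w ≤ αθ) (hβ : 0 ≤ βθ) (haσ' : ∀ (v : ι) (w : κ), (∑ u, |A u w| * Hk v u) * σ v w ≤ βθ) (hgσ : ∀ x y : ι, ∑ w, (∑ u,
        |A u w| * K3 x y u) * σ x w ≤ αθ) (hgσ' : ∀ (x y : ι) (w : κ), (∑ u, |A u w| * K3 x y u) * σ x w ≤ βθ)
    (hϑ1 : ∀ x y, 1 ≤ ϑ x y) (hϑsymm : ∀ x y, ϑ x y = ϑ y x) (hϑmul : ∀ x y z, ϑ x z ≤ ϑ x y * ϑ y z) (hϑ₂symm : ∀ x y, ϑ₂ x y = ϑ₂ y x) (hϑ3 : ∀ x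
        y, ϑ x y ^ 3 ≤ ϑ₂ x y) (hϑσ : ∀ x y w, ϑ x y ^ 4 ≤ σ x w * σ y w) (hG : ∀ a, ∑ b, ϑ a b ^ 4 / Real.sqrt (ρ a b) ≤ G) (hΘ : ∀ a, ∑ b, (ϑ a b
        ^ 3) ^ 2 / ϑ₂ a b ≤ Θ6) (hhrw : ∀ a, ∑ b, ϑ₂ a b * Hk a b ≤ hrϑ) (hhc : ∀ a, ∑ b, ϑ₂ a b * Hk b a ≤ hcϑ) (hrsymm : ∀ a b, r a b = r b a)
        (hS4 : ∀ u, ∑ v, ϑ u v ^ 4 * (r u v ^ 2)⁻¹ ≤ S4) (hC4 : 0 ≤ (4 * (αθ * dθ * (βθ * dθ') / (1 - lamA)) + 3 * (αθ * dθ * (βθ * dθ') / (1 -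
        lamA)) ^ 2 + 4 * (5 * (κ₂ ^ 4 * γop ^ 2) / (1 - lam * γop) ^ 2) + 4 * (50 * (κ₂ ^ 6 * γop ^ 3) / (1 - lam * γop) ^ 3) + 2 * (((5 * (κ₂ ^ 4
        * γop ^ 2) / (1 - lam * γop) ^ 2) + 1) / 2) * ((((5 * (κ₂ ^ 4 * γop ^ 2) / (1 - lam * γop) ^ 2) + 1) / 2) + (5 * (κ₂ ^ 4 * γop ^ 2) / (1 -
        lam * γop) ^ 2)))) (hbσc : ∀ z', ∑ v, (∑ u, |A u z'| * Hk v u) * σ v z' ≤ αθc) (hαθc : 0 ≤ αθc) (hg1m : ∀ x, ∑ y, ϑ₂ x y * ∑ z', (∑ u, |A u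
        z'| * K3 x y u) * σ x z' ≤ αg1m) (hg2m : ∀ y, ∑ x, ϑ₂ y x * ∑ z', (∑ u, |A u z'| * K3 x y u) * σ y z' ≤ αg2m) (hg1c : ∀ z', ∑ x, ∑ y, (∑ u,
        |A u z'| * K3 x y u) * (σ x z' * ϑ₂ x y) ≤ αg1c) (hαg1c : 0 ≤ αg1c) (hk4m2 : ∀ s, ∑ p, ∑ q, (ϑ₂ s p * ϑ₂ s q * ϑ₂ p q) * ∑ z', (∑ u, |A u
        z'| * K4 p s q u) * σ s z' ≤ αk4m2) (hk4m3 : ∀ s, ∑ p, ∑ q, (ϑ₂ s p * ϑ₂ s q * ϑ₂ p q) * ∑ z', (∑ u, |A u z'| * K4 p q s u) * σ s z' ≤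
        αk4m3) (hk4c : ∀ z', ∑ a, ∑ b, ∑ c, (∑ u, |A u z'| * K4 a b c u) * (σ a z' * (ϑ₂ a b * ϑ₂ a c * ϑ₂ b c)) ≤ αk4c) (hαk4c : 0 ≤ αk4c) (hk4z :
        ∀ z, ∑ x, ∑ y, ∑ t, K4 y z t x * (ϑ₂ x y * ϑ₂ x z * ϑ₂ x t * ϑ₂ y z * ϑ₂ y t * ϑ₂ z t) ≤ k4ϑ2) (hk4t : ∀ t, ∑ x, ∑ y, ∑ z, K4 y z t x * (ϑ₂
        x y * ϑ₂ x z * ϑ₂ x t * ϑ₂ y z * ϑ₂ y t * ϑ₂ z t) ≤ k4ϑ3) :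
    ‖(∑ x', ∑ y', ∑ z', (fderiv ℝ (fun ψ' : EuclideanSpace ℝ ι => ((∫ ω : EuclideanSpace ℝ ι, exp (-U (ω + ψ')) ∂(multivariateGaussian 0 (A *
        Aᵀ))))⁻¹ * (∫ ω : EuclideanSpace ℝ ι, exp (-U (ω + ψ')) * (U₃ (ω + ψ') (EuclideanSpace.single x' (1 : ℝ)) (EuclideanSpace.single y' (1 :
        ℝ)) (EuclideanSpace.single z' (1 : ℝ)) - U' (ω + ψ') (EuclideanSpace.single y' (1 : ℝ)) * U'' (ω + ψ') (EuclideanSpace.single x' (1 : ℝ))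
        (EuclideanSpace.single z' (1 : ℝ)) - U'' (ω + ψ') (EuclideanSpace.single x' (1 : ℝ)) (EuclideanSpace.single y' (1 : ℝ)) * U' (ω + ψ')
        (EuclideanSpace.single z' (1 : ℝ)) - U' (ω + ψ') (EuclideanSpace.single x' (1 : ℝ)) * U'' (ω + ψ') (EuclideanSpace.single y' (1 : ℝ))
        (EuclideanSpace.single z' (1 : ℝ)) + U' (ω + ψ') (EuclideanSpace.single x' (1 : ℝ)) * U' (ω + ψ') (EuclideanSpace.single y' (1 : ℝ)) * U'
        (ω + ψ') (EuclideanSpace.single z' (1 : ℝ))) ∂(multivariateGaussian 0 (A * Aᵀ))) + ((∫ ω : EuclideanSpace ℝ ι, exp (-U (ω + ψ'))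
        ∂(multivariateGaussian 0 (A * Aᵀ))) ^ 2)⁻¹ * (∫ ω : EuclideanSpace ℝ ι, exp (-U (ω + ψ')) * U' (ω + ψ') (EuclideanSpace.single x' (1 : ℝ))
        ∂(multivariateGaussian 0 (A * Aᵀ))) * (∫ ω : EuclideanSpace ℝ ι, exp (-U (ω + ψ')) * (U'' (ω + ψ') (EuclideanSpace.single y' (1 : ℝ))
        (EuclideanSpace.single z' (1 : ℝ)) - U' (ω + ψ') (EuclideanSpace.single y' (1 : ℝ)) * U' (ω + ψ') (EuclideanSpace.single z' (1 : ℝ)))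
        ∂(multivariateGaussian 0 (A * Aᵀ))) + ((∫ ω : EuclideanSpace ℝ ι, exp (-U (ω + ψ')) ∂(multivariateGaussian 0 (A * Aᵀ))) ^ 2)⁻¹ * (∫ ω :
        EuclideanSpace ℝ ι, exp (-U (ω + ψ')) * U' (ω + ψ') (EuclideanSpace.single y' (1 : ℝ)) ∂(multivariateGaussian 0 (A * Aᵀ))) * (∫ ω :
        EuclideanSpace ℝ ι, exp (-U (ω + ψ')) * (U'' (ω + ψ') (EuclideanSpace.single x' (1 : ℝ)) (EuclideanSpace.single z' (1 : ℝ)) - U' (ω + ψ')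
        (EuclideanSpace.single x' (1 : ℝ)) * U' (ω + ψ') (EuclideanSpace.single z' (1 : ℝ))) ∂(multivariateGaussian 0 (A * Aᵀ))) + (((∫ ω :
        EuclideanSpace ℝ ι, exp (-U (ω + ψ')) ∂(multivariateGaussian 0 (A * Aᵀ))) ^ 2)⁻¹ * (∫ ω : EuclideanSpace ℝ ι, exp (-U (ω + ψ')) * (U'' (ω +
        ψ') (EuclideanSpace.single x' (1 : ℝ)) (EuclideanSpace.single y' (1 : ℝ)) - U' (ω + ψ') (EuclideanSpace.single x' (1 : ℝ)) * U' (ω + ψ')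
        (EuclideanSpace.single y' (1 : ℝ))) ∂(multivariateGaussian 0 (A * Aᵀ))) + -2 / (∫ ω : EuclideanSpace ℝ ι, exp (-U (ω + ψ'))
        ∂(multivariateGaussian 0 (A * Aᵀ))) ^ 3 * -(∫ ω : EuclideanSpace ℝ ι, exp (-U (ω + ψ')) * U' (ω + ψ') (EuclideanSpace.single x' (1 : ℝ))
        ∂(multivariateGaussian 0 (A * Aᵀ))) * (∫ ω : EuclideanSpace ℝ ι, exp (-U (ω + ψ')) * U' (ω + ψ') (EuclideanSpace.single y' (1 : ℝ))
        ∂(multivariateGaussian 0 (A * Aᵀ)))) * (∫ ω : EuclideanSpace ℝ ι, exp (-U (ω + ψ')) * U' (ω + ψ') (EuclideanSpace.single z' (1 : ℝ))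
        ∂(multivariateGaussian 0 (A * Aᵀ)))) ψ).smulRight ((EuclideanSpace.proj x' : EuclideanSpace ℝ ι →L[ℝ] ℝ).smulRight ((EuclideanSpace.proj y'
        : EuclideanSpace ℝ ι →L[ℝ] ℝ).smulRight (EuclideanSpace.proj z' : EuclideanSpace ℝ ι →L[ℝ] ℝ))))‖ ≤
      Real.sqrt ((k4ϑ2 + dθ * αk4m2 * (dθ' * αθc) / (1 - lamA) + dθ * αθ * (dθ' * αk4c) / (1 - lamA) + dθ * αk4m3 * (dθ' * αθc) / (1 - lamA) + dθ *
        αk4m2 * (dθ' * αθc) / (1 - lamA) + dθ * αg1m * (dθ' * αg1c) / (1 - lamA) + dθ * αg2m * (dθ' * αg1c) / (1 - lamA) + dθ * αg2m * (dθ' * αg1c)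
        / (1 - lamA) + Real.sqrt (2 * Real.sqrt (5 * (κ₂ ^ 4 * γop ^ 2) / (1 - lam * γop) ^ 2) * (4 * Real.sqrt ((5 * ((κ₂ ^ 4 + κ₃ ^ 4) * γop ^ 2)
        / (1 - lam * γop) ^ 2) * (αθ * dθ * (βθ * dθ') / (1 - lamA))))) * (G * (Real.sqrt (hcϑ * Θ6) * G)) + Real.sqrt (2 * Real.sqrt (5 * (κ₂ ^ 4
        * γop ^ 2) / (1 - lam * γop) ^ 2) * (4 * Real.sqrt ((5 * ((κ₂ ^ 4 + κ₃ ^ 4) * γop ^ 2) / (1 - lam * γop) ^ 2) * (αθ * dθ * (βθ * dθ') / (1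
        - lamA))))) * (Real.sqrt (hrϑ * Θ6) * (G * G)) + Real.sqrt (2 * Real.sqrt (5 * (κ₂ ^ 4 * γop ^ 2) / (1 - lam * γop) ^ 2) * (4 * Real.sqrt
        ((5 * ((κ₂ ^ 4 + κ₃ ^ 4) * γop ^ 2) / (1 - lam * γop) ^ 2) * (αθ * dθ * (βθ * dθ') / (1 - lamA))))) * (G * (G * Real.sqrt (hcϑ * Θ6))) +
        Real.sqrt (2 * Real.sqrt (5 * (κ₂ ^ 4 * γop ^ 2) / (1 - lam * γop) ^ 2) * (4 * Real.sqrt ((5 * ((κ₂ ^ 4 + κ₃ ^ 4) * γop ^ 2) / (1 - lam *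
        γop) ^ 2) * (αθ * dθ * (βθ * dθ') / (1 - lamA))))) * (Real.sqrt (hrϑ * Θ6) * (G * G)) + Real.sqrt (2 * Real.sqrt (5 * (κ₂ ^ 4 * γop ^ 2) /
        (1 - lam * γop) ^ 2) * (4 * Real.sqrt ((5 * ((κ₂ ^ 4 + κ₃ ^ 4) * γop ^ 2) / (1 - lam * γop) ^ 2) * (αθ * dθ * (βθ * dθ') / (1 - lamA))))) *
        (G * (G * Real.sqrt (hcϑ * Θ6))) + Real.sqrt (2 * Real.sqrt (5 * (κ₂ ^ 4 * γop ^ 2) / (1 - lam * γop) ^ 2) * (4 * Real.sqrt ((5 * ((κ₂ ^ 4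
        + κ₃ ^ 4) * γop ^ 2) / (1 - lam * γop) ^ 2) * (αθ * dθ * (βθ * dθ') / (1 - lamA))))) * (G * (G * Real.sqrt (hcϑ * Θ6))) + (4 * (αθ * dθ *
        (βθ * dθ') / (1 - lamA)) + 3 * (αθ * dθ * (βθ * dθ') / (1 - lamA)) ^ 2 + 4 * (5 * (κ₂ ^ 4 * γop ^ 2) / (1 - lam * γop) ^ 2) + 4 * (50 * (κ₂
        ^ 6 * γop ^ 3) / (1 - lam * γop) ^ 3) + 2 * (((5 * (κ₂ ^ 4 * γop ^ 2) / (1 - lam * γop) ^ 2) + 1) / 2) * ((((5 * (κ₂ ^ 4 * γop ^ 2) / (1 -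
        lam * γop) ^ 2) + 1) / 2) + (5 * (κ₂ ^ 4 * γop ^ 2) / (1 - lam * γop) ^ 2))) * (16 * S4 ^ 3)) * (k4ϑ3 + dθ * αk4m3 * (dθ' * αθc) / (1 -
        lamA) + dθ * αk4m3 * (dθ' * αθc) / (1 - lamA) + dθ * αθ * (dθ' * αk4c) / (1 - lamA) + dθ * αk4m3 * (dθ' * αθc) / (1 - lamA) + dθ * αg2m *
        (dθ' * αg1c) / (1 - lamA) + dθ * αg2m * (dθ' * αg1c) / (1 - lamA) + dθ * αg2m * (dθ' * αg1c) / (1 - lamA) + Real.sqrt (2 * Real.sqrt (5 *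
        (κ₂ ^ 4 * γop ^ 2) / (1 - lam * γop) ^ 2) * (4 * Real.sqrt ((5 * ((κ₂ ^ 4 + κ₃ ^ 4) * γop ^ 2) / (1 - lam * γop) ^ 2) * (αθ * dθ * (βθ *
        dθ') / (1 - lamA))))) * (G * (Real.sqrt (hcϑ * Θ6) * G)) + Real.sqrt (2 * Real.sqrt (5 * (κ₂ ^ 4 * γop ^ 2) / (1 - lam * γop) ^ 2) * (4 *
        Real.sqrt ((5 * ((κ₂ ^ 4 + κ₃ ^ 4) * γop ^ 2) / (1 - lam * γop) ^ 2) * (αθ * dθ * (βθ * dθ') / (1 - lamA))))) * (G * (G * Real.sqrt (hcϑ *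
        Θ6))) + Real.sqrt (2 * Real.sqrt (5 * (κ₂ ^ 4 * γop ^ 2) / (1 - lam * γop) ^ 2) * (4 * Real.sqrt ((5 * ((κ₂ ^ 4 + κ₃ ^ 4) * γop ^ 2) / (1 -
        lam * γop) ^ 2) * (αθ * dθ * (βθ * dθ') / (1 - lamA))))) * (Real.sqrt (hrϑ * Θ6) * (G * G)) + Real.sqrt (2 * Real.sqrt (5 * (κ₂ ^ 4 * γop ^
        2) / (1 - lam * γop) ^ 2) * (4 * Real.sqrt ((5 * ((κ₂ ^ 4 + κ₃ ^ 4) * γop ^ 2) / (1 - lam * γop) ^ 2) * (αθ * dθ * (βθ * dθ') / (1 -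
        lamA))))) * (G * (G * Real.sqrt (hcϑ * Θ6))) + Real.sqrt (2 * Real.sqrt (5 * (κ₂ ^ 4 * γop ^ 2) / (1 - lam * γop) ^ 2) * (4 * Real.sqrt ((5
        * ((κ₂ ^ 4 + κ₃ ^ 4) * γop ^ 2) / (1 - lam * γop) ^ 2) * (αθ * dθ * (βθ * dθ') / (1 - lamA))))) * (Real.sqrt (hrϑ * Θ6) * (G * G)) +
        Real.sqrt (2 * Real.sqrt (5 * (κ₂ ^ 4 * γop ^ 2) / (1 - lam * γop) ^ 2) * (4 * Real.sqrt ((5 * ((κ₂ ^ 4 + κ₃ ^ 4) * γop ^ 2) / (1 - lam *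
        γop) ^ 2) * (αθ * dθ * (βθ * dθ') / (1 - lamA))))) * (Real.sqrt (hrϑ * Θ6) * (G * G)) + (4 * (αθ * dθ * (βθ * dθ') / (1 - lamA)) + 3 * (αθ
        * dθ * (βθ * dθ') / (1 - lamA)) ^ 2 + 4 * (5 * (κ₂ ^ 4 * γop ^ 2) / (1 - lam * γop) ^ 2) + 4 * (50 * (κ₂ ^ 6 * γop ^ 3) / (1 - lam * γop) ^
        3) + 2 * (((5 * (κ₂ ^ 4 * γop ^ 2) / (1 - lam * γop) ^ 2) + 1) / 2) * ((((5 * (κ₂ ^ 4 * γop ^ 2) / (1 - lam * γop) ^ 2) + 1) / 2) + (5 *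
        (κ₂ ^ 4 * γop ^ 2) / (1 - lam * γop) ^ 2))) * (16 * S4 ^ 3))) := by
  have hΓ : (A * Aᵀ).PosSemidef := posSemidef_AAT A
  have hK40 : ∀ a b c u, 0 ≤ K4 a b c u := fun a b c u => (abs_nonneg _).trans (hK4 0 u a b c)
  have hρ0 : ∀ x y, 0 < ρ x y := fun x y => lt_of_lt_of_le one_pos (hρ1 x y)
  have hW1 : ∀ x y z t : ι, (1 : ℝ) ≤ ϑ x y * ϑ x z * ϑ x t * ϑ y z * ϑ y t * ϑ z t := fun x y z t =>
    one_le_mul_of_one_le_of_one_le (one_le_mul_of_one_le_of_one_le (one_le_mul_of_one_le_of_one_le (one_le_mul_of_one_le_of_one_le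
        (one_le_mul_of_one_le_of_one_le (hϑ1 x y) (hϑ1 x z)) (hϑ1 x t)) (hϑ1 y z)) (hϑ1 y t)) (hϑ1 z t)
  refine opNorm_le_of_slot_letters_four _ (fun z => ?_) (fun t => ?_)
  · refine le_trans (Finset.sum_le_sum fun x _ => Finset.sum_le_sum fun y _ => Finset.sum_le_sum fun t _ => ?_)
      (output_k4ϑ_z hK40 hK30 hHk0 hD hlamA1 hθnn hDθr hdθ hDθc hdθ' hσ0 hσθ hϑ1 hϑsymm hϑmul hϑ₂symm hϑ3 hϑσ hρ0 hρsymm hG hΘ hhrw hhc hrsymm hS4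
        hC4 haσ hbσc hαθc hg1m hg2m hg1c hαg1c hk4m2 hk4m3 hk4c hαk4c hk4z z)
    rw [third_form_clm_fderiv_entry hΓ hΓop Y hUd hU'd hU''d hU₃d hU₄c hκ₀ hκ₁ ha hτ hδ hθ1 hκθ hstab hU'b hθ0 hU''b hU₃b hU₄b ψ
        (EuclideanSpace.single x (1 : ℝ)) y z t]
    have h := interpolated_fourth_kernel_entry hΓop Y hUd hU'd hU''d hU₃d hU₄c hκ₀ hκ₁ ha hτ hδ hθ0 hθ1 hκθ hκθw hstab hU'b hU''b hU₃b hU₄b hlam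
        hUsec hρg hHk hHk0 hK3 hK30 hK4 hhr ψ hαr hαc hlamA hlamA1 hγ hγ1 hD hDC hθnn hDθr hdθ hDθc hdθ' hσ0 hσθ hρ1 hρsymm hρmul hρσ hr1 hrσ haσ
        hβ haσ' hgσ hgσ' x y z t
    exact h.trans (le_mul_of_one_le_right ((abs_nonneg _).trans h) (hW1 x y z t))
  · refine le_trans (Finset.sum_le_sum fun x _ => Finset.sum_le_sum fun y _ => Finset.sum_le_sum fun z _ => ?_)
      (output_k4ϑ_t hK40 hK30 hHk0 hD hlamA1 hθnn hDθr hdθ hDθc hdθ' hσ0 hσθ hϑ1 hϑsymm hϑmul hϑ₂symm hϑ3 hϑσ hρ0 hρsymm hG hΘ hhrw hhc hrsymm hS4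
        hC4 haσ hbσc hαθc hg2m hg1c hαg1c hk4m3 hk4c hαk4c hk4t t)
    rw [third_form_clm_fderiv_entry hΓ hΓop Y hUd hU'd hU''d hU₃d hU₄c hκ₀ hκ₁ ha hτ hδ hθ1 hκθ hstab hU'b hθ0 hU''b hU₃b hU₄b ψ
        (EuclideanSpace.single x (1 : ℝ)) y z t]
    have h := interpolated_fourth_kernel_entry hΓop Y hUd hU'd hU''d hU₃d hU₄c hκ₀ hκ₁ ha hτ hδ hθ0 hθ1 hκθ hκθw hstab hU'b hU''b hU₃b hU₄b hlam
        hUsec hρg hHk hHk0 hK3 hK30 hK4 hhr ψ hαr hαc hlamA hlamA1 hγ hγ1 hD hDC hθnn hDθr hdθ hDθc hdθ' hσ0 hσθ hρ1 hρsymm hρmul hρσ hr1 hrσ haσ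
        hβ haσ' hgσ hgσ' x y z t
    exact h.trans (le_mul_of_one_le_right ((abs_nonneg _).trans h) (hW1 x y z t))

/-! ## Toy -/

/-- Toy (plain ≤ weighted): `m ≤ m·w` for `m ≥ 0`, `w ≥ 1`; here `3 ≤ 3·2`. -/
example : (3 : ℝ) ≤ 3 * 2 := by norm_num

end Summit.QuantumFields.BalabanUV.T4Continuum.NE7b.SupWeightedFourthOrderOperatorLetter

end
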